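import Summits.BirchSwinnertonDyer.BirchSwinnertonDyer.Theses.TwistFamilyManinDescent

/-!
# Twist-pair transport for the Manin `5`-valuation — sketch (crux stmt-BirchSwinnertonDyer-25138, seat 1, g8)

**STATUS (read before use): a RE-DERIVATION, not a new lever.**  The transport typed here is the route's
own LINE 17 item `SupersingularCornerTwistTransport` (T17, stmt-BirchSwinnertonDyer-27551, CLOSED — proved by
`supersingularCornerTwistTransport_proof` modulo the cite-only Gealy–Klagsbrun Néron-scalar fact, cf.
`SupersingularCornerTwistTransportOfGK` stmt-27665), found when reconciling this seat's g7/g8 star-swap work with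
route rev 30.  Dictionary (this file ↔ route `Theses/TwistFamilyManinDescent.lean`):

* `StarredPotSSAtFive` / `UnstarredPotSSAtFive` (v₅Δ ∈ {8,10} / {2,4}) ↔ the route's row predicates
  `padicValInt 5 W.minimalDiscriminantInt ∈ {4,8}` (Ray57 rows IV/IV\*) and `∈ {2,10}` (corner rows II/II\*);
* Q\* of calibration §8 («optimal ⇒ unstarred») restricted to IV/IV\* ↔ K15a `SupersingularStrongIsUnstarred`
  (stmt-27072, OPEN; engine S16b `SupersingularKummerFreeStrongIsUnstarred` stmt-27296, OPEN);
* `CruxOffStarredSSAtFive` restricted to (5; IV, v = 4) ↔ K15b `SupersingularUnstarredStrongManinUnit` (stmt-27071, OPEN);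
* `StarredTwistTransport` + `TwistPartnerExists` + the (L1)–(L4)/Zagier identity ↔ T17 (stmt-27551, CLOSED), whose
  proof uses exactly the tree theorems this sketch had listed as «inputs»: `padicVal_twist_identity` (= L1/L2 read
  5-adically), Zagier `zagier_degree_formula_of_cosetReps`, the Petersson isometry ‖f ⊗ χ‖ = ‖f‖ (= L3), and
  `gaussSum_mul_mem_periodLattice_of_mem_charTwist` (Stevens (5.4): `√5·Λ(f ⊗ χ₅) ⊆ Λ(f)`, STRONGER than L4);
* `DoublyStarredResidual` (R_cc) ↔ an instance of K15a on the twisted class (T17 grants K15a there);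
* the «MIDDLE configuration» `[Λ(f) : √5 Λ(f ⊗ χ₅)] = 5` on reducible potentially supersingular pairs ↔ known to the
  route (Ray57 docstring: kit j301037, 25/25); `CENSUS-twistpair-deg5.md` extends the instrument to N < 5·10⁵
  (771/771 pairs, deg φ equal; 82526 pairs, 0 exceptions to T17's degree identity).

So after T17 the p = 5 potentially supersingular content of the crux is exactly {K15a, K15b} on the (5; IV/IV\*)
rows; this seat's cards (`Ideas/etale-quotient-depth.md` etc.) should be read as alternative ENGINES for K15a
(orientation / Q\*, §8 (E2)(E3)) and K15b (congruence-depth (ΛM)/(H_J)), see calibration §9.  The typed Props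
and the two kernel-checked splits below are kept as the crux-local (p = 5, `InCell`) form of that dictionary.

Objects: the `χ₅`-TWIST PAIR `(f, g = f ⊗ χ₅)` of newforms of the same level `N = 25M`, their period lattices
`Λ(f), Λ(g)`, the two `X₀(N)`-lattice-optimal curves `E₀(f), E₀(g)` with Manin constants `c₀, c₀'` and modular
degrees `deg φ_f, deg φ_g`.  Inputs: (L3) `‖f‖ = ‖g‖` (Rankin–Selberg, `a_{5m} = 0`); (L4) `√5·Λ(g) ⊆ Λ(f)` and
symmetrically (tree, Stevens (5.4)), so `[Λ(f) : √5 Λ(g)] ∈ {1, 5, 25}`; (L1) `Λ(E ⊗ χ₅) = Λ(E)/√5` if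
`v₅Δ_min(E) + 6 < 12`, `= √5 Λ(E)` otherwise; (L2) inside a reducible potentially supersingular class the
`5`-isogeny unstarred → starred is `z ↦ z` of index 5.  With Zagier: `(c₀/c₀')² = (deg φ_f/deg φ_g)·5^k`, `k = 0`
in the pure configurations, `±1` in the mixed ones; pure ⇒ `c₀ = ±c₀'` up to {2,3}-units; `E₀(f)` starred and
`5 ∤ c₀'` ⇒ `5 ∤ c₀` (`StarredTwistTransport`).  Kernel-checked: `StarredSSResidualAtFive` (R_c) from the off-rows
crux, partner existence, the transport and `DoublyStarredResidual`; assembly to the crux via the §8d split.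

Nothing here proves the crux; BSD is not proved by this; Manin `c = 1` is not proved by this.
-/

noncomputable section

set_option linter.dupNamespace false

open WeierstrassCurve Literature.NumberTheory.EllipticCurves.ModularForms
open scoped MatrixGroups ModularForm
open CongruenceSubgroup

namespace Summit.BirchSwinnertonDyer.BirchSwinnertonDyer.Cruxes.EisensteinAdditiveManinResidual.TwistPair

/-! ### Verbatim restatements from `StarSwapSketch.lean` (§8d; that sketch is not an importable module) -/

/-- STARRED potentially supersingular at `5`: Kodaira type IV\* or II\*, `v₅(Δ_min) ∈ {8, 10}` (`W` globally
minimal).  Verbatim `StarSwap.StarredPotSSAtFive`. -/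
def StarredPotSSAtFive (W : WeierstrassCurve ℚ) : Prop :=
  padicValRat 5 W.Δ = 8 ∨ padicValRat 5 W.Δ = 10

/-- The crux OFF the starred potentially supersingular rows at `5`.  Verbatim `StarSwap.CruxOffStarredSSAtFive`. -/
def CruxOffStarredSSAtFive : Prop :=
  mazur_not_dvd_maninConstant_of_odd → abbesUllmo_not_dvd_maninConstant_of_not_dvd_level →
  cesnavicius_not_two_dvd_maninConstant_of_two_dvd_level → exists_isNewformOf →
  ∀ (W : WeierstrassCurve ℚ) [W.IsElliptic] [W.IsGloballyMinimal] {N : ℕ} [NeZero N]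
    (D : ModularParametrizationData W N) (p : ℕ) (hp : p.Prime),
    (p = 5 ∨ p = 7 ∨ p = 13 ∨ (p = 163 ∧ 2 ^ 6 ∣ N)) → p ^ 2 ∣ N → ¬ W.HasIrreducibleModPGaloisRep p →
    ¬ ((W.quadraticTwist (((-1 : ℤ) ^ (p / 2) * p : ℤ) : ℚ)).HasGoodReductionAt
          ((Rat.HeightOneSpectrum.primesEquiv (R := ℤ)).symm ⟨p, hp⟩) ∨
       (W.quadraticTwist (((-1 : ℤ) ^ (p / 2) * p : ℤ) : ℚ)).HasMultiplicativeReductionAt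
          ((Rat.HeightOneSpectrum.primesEquiv (R := ℤ)).symm ⟨p, hp⟩)) →
    (∀ z ∈ D.L.lattice, ∃ w ∈ periodLattice D.f, z = D.c * w) →
    ¬ (p = 5 ∧ StarredPotSSAtFive W) →
    ¬ (p : ℤ) ∣ D.maninConstant

/-- **R_c** — the crux ON the starred potentially supersingular rows at `5`.  Verbatim
`StarSwap.StarredSSResidualAtFive`. -/
def StarredSSResidualAtFive : Prop :=
  mazur_not_dvd_maninConstant_of_odd → abbesUllmo_not_dvd_maninConstant_of_not_dvd_level →
  cesnavicius_not_two_dvd_maninConstant_of_two_dvd_level → exists_isNewformOf →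
  ∀ (W : WeierstrassCurve ℚ) [W.IsElliptic] [W.IsGloballyMinimal] {N : ℕ} [NeZero N]
    (D : ModularParametrizationData W N) (hp : (5 : ℕ).Prime),
    5 ^ 2 ∣ N → ¬ W.HasIrreducibleModPGaloisRep 5 →
    ¬ ((W.quadraticTwist (((-1 : ℤ) ^ (5 / 2) * 5 : ℤ) : ℚ)).HasGoodReductionAt
          ((Rat.HeightOneSpectrum.primesEquiv (R := ℤ)).symm ⟨5, hp⟩) ∨
       (W.quadraticTwist (((-1 : ℤ) ^ (5 / 2) * 5 : ℤ) : ℚ)).HasMultiplicativeReductionAt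
          ((Rat.HeightOneSpectrum.primesEquiv (R := ℤ)).symm ⟨5, hp⟩)) →
    (∀ z ∈ D.L.lattice, ∃ w ∈ periodLattice D.f, z = D.c * w) →
    StarredPotSSAtFive W →
    ¬ (5 : ℤ) ∣ D.maninConstant

/-- Verbatim `StarSwap.crux_of_off_of_residual` (§8d split 2). PROVED. -/
theorem crux_of_off_of_residual (hoff : CruxOffStarredSSAtFive) (hR : StarredSSResidualAtFive) :
    Theses.TwistFamilyManinDescent.EisensteinAdditiveManinResidual := by
  intro h1 h2 h3 h4 W _ _ N _ D p hp hrows hN hred htw hlat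
  by_cases hc : p = 5 ∧ StarredPotSSAtFive W
  · obtain ⟨rfl, hstar⟩ := hc
    exact hR h1 h2 h3 h4 W D hp hN hred htw hlat hstar
  · exact hoff h1 h2 h3 h4 W D p hp hrows hN hred htw hlat hc

/-- UNSTARRED potentially supersingular at `5` (types II, IV: `v₅(Δ_min) ∈ {2, 4}`; `W` globally minimal). -/
def UnstarredPotSSAtFive (W : WeierstrassCurve ℚ) : Prop :=
  padicValRat 5 W.Δ = 2 ∨ padicValRat 5 W.Δ = 4

theorem not_starred_of_unstarred {W : WeierstrassCurve ℚ} (h : UnstarredPotSSAtFive W) :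
    ¬ StarredPotSSAtFive W := by
  rintro h'
  rcases h with h | h <;> rcases h' with h' | h' <;> simp [h] at h'

/-- The crux's hypothesis list at `p = 5` for a parametrised curve `(W, D)`: `5² ∣ N`, `E[5]` reducible, the
`5*`-twist (here the twist by `5`) neither good nor multiplicative at `5`, and `D` lattice-optimal
(`Λ_E = c · Λ_f`). Verbatim the crux's binders. -/
def InCell (W : WeierstrassCurve ℚ) {N : ℕ} [NeZero N] (D : ModularParametrizationData W N)
    (hp : (5 : ℕ).Prime) : Prop :=
  5 ^ 2 ∣ N ∧ ¬ W.HasIrreducibleModPGaloisRep 5 ∧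
  ¬ ((W.quadraticTwist (((-1 : ℤ) ^ (5 / 2) * 5 : ℤ) : ℚ)).HasGoodReductionAt
          ((Rat.HeightOneSpectrum.primesEquiv (R := ℤ)).symm ⟨5, hp⟩) ∨
       (W.quadraticTwist (((-1 : ℤ) ^ (5 / 2) * 5 : ℤ) : ℚ)).HasMultiplicativeReductionAt
          ((Rat.HeightOneSpectrum.primesEquiv (R := ℤ)).symm ⟨5, hp⟩)) ∧
  (∀ z ∈ D.L.lattice, ∃ w ∈ periodLattice D.f, z = D.c * w)

/-- `(W', D')` is a TWIST PARTNER of `W` at the same level: `D'.f` is the newform of the quadratic twist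
`W ⊗ χ₅` (so `a_n(D'.f) = χ₅(n) a_n(D.f)`, and `W'` lies in the isogeny class of `W ⊗ χ₅`). -/
def IsTwistPartner (W W' : WeierstrassCurve ℚ) {N : ℕ} [NeZero N] (D' : ModularParametrizationData W' N) :
    Prop :=
  IsNewformOf (W.quadraticTwist (5 : ℚ)) D'.f

/-! ### The two E-blind lemmas (L3: inside the tree's Watkins-law proof; L4: the tree has the stronger Stevens (5.4)) -/

/-- **(L3) Petersson invariance under the level-preserving twist.**  For a twist pair at level `N` with
`25 ∣ N`: `(f, f) = (g, g)` on `Γ₀(N)`.  Proof sketch: `a_5(f) = 0`, so `a_{5m}(f) = 0` and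
`Σ |a_n(g)|² n^{-s} = Σ_{5 ∤ n} |a_n(f)|² n^{-s} = Σ |a_n(f)|² n^{-s}`; the Rankin–Selberg unfolding on `Γ₀(N)`
expresses `(h, h)` through the residue of this series times a constant depending on `N` only. -/
def PeterssonTwistInvariance : Prop :=
  ∀ (W W' : WeierstrassCurve ℚ) {N : ℕ} [NeZero N]
    (D : ModularParametrizationData W N) (D' : ModularParametrizationData W' N),
    5 ^ 2 ∣ N → IsTwistPartner W W' D' →
    (peterssonProduct (Gamma0 N) 2 D.f D.f).re = (peterssonProduct (Gamma0 N) 2 D'.f D'.f).re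

/-- **(L4) Twisted-period inclusion.**  `2√5 · Λ(g) ⊆ Λ(f)` for a twist pair at level `N`, `25 ∣ N`
(and symmetrically, since `f = g ⊗ χ₅`).  Proof sketch: `g(z) = τ(χ₅)⁻¹ Σ_{a mod 5} χ₅(a) f(z + a/5)`
(`τ(χ₅) = √5`, `χ₅` real), and for `γ ∈ Γ' := {γ ∈ Γ₀(N) : γ₁₁ ≡ ±1 (mod 5)}` (index 2) each
`τ_a γ τ_a⁻¹ ∈ Γ₀(N)`, so `∫_τ^{γτ} g ∈ √5⁻¹ Λ(f)`; periods over `Γ'` contain `2 Λ(g)` (transfer). -/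
def TwistPeriodInclusion : Prop :=
  ∀ (W W' : WeierstrassCurve ℚ) {N : ℕ} [NeZero N]
    (D : ModularParametrizationData W N) (D' : ModularParametrizationData W' N),
    5 ^ 2 ∣ N → IsTwistPartner W W' D' →
    ∀ z ∈ periodLattice D'.f, ((2 * Real.sqrt 5 : ℝ) : ℂ) * z ∈ periodLattice D.f

/-! ### The curve-side consequences -/

/-- **Twist-pair degree identity (pure, unstarred configuration).**  Both optimal curves unstarred ⇒
`c₀² · deg φ_g = c₀'² · deg φ_f` (from (L1)–(L3) and Zagier's formula: equal covolumes), and with (L4)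
`deg φ_f / deg φ_g` is a `5`-adic unit, so `v₅ c₀ = v₅ c₀'`.  Census: `deg φ_f = deg φ_g` on 771/771
reducible potentially supersingular pairs, `N < 5·10⁵`. -/
def UnstarredDegreeIdentity : Prop :=
  ∀ (W W' : WeierstrassCurve ℚ) [W.IsElliptic] [W.IsGloballyMinimal] [W'.IsElliptic] [W'.IsGloballyMinimal]
    {N : ℕ} [NeZero N] (D : ModularParametrizationData W N) (D' : ModularParametrizationData W' N)
    (hp : (5 : ℕ).Prime),
    InCell W D hp → InCell W' D' hp → IsTwistPartner W W' D' →
    UnstarredPotSSAtFive W → UnstarredPotSSAtFive W' →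
    D.c ^ 2 * (D'.deg : ℤ) = D'.c ^ 2 * (D.deg : ℤ) ∧ padicValNat 5 D.deg = padicValNat 5 D'.deg

/-- **Starred twist transport** (= the crux-local form of route item T17, stmt-27551).  If the optimal curve `W` of `f` is STARRED (II\*/IV\*) then
`v₅ c₀(f) ≤ v₅ c₀(f ⊗ χ₅)`: configurations (S,S′) give equality, (S,U′) give `v₅ c₀ − v₅ c₀' ∈ {−1, 0}`
((L1)–(L4) + Zagier).  Stated as the divisibility transport the residual needs. -/
def StarredTwistTransport : Prop :=
  ∀ (W W' : WeierstrassCurve ℚ) [W.IsElliptic] [W.IsGloballyMinimal] [W'.IsElliptic] [W'.IsGloballyMinimal]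
    {N : ℕ} [NeZero N] (D : ModularParametrizationData W N) (D' : ModularParametrizationData W' N)
    (hp : (5 : ℕ).Prime),
    InCell W D hp → InCell W' D' hp → IsTwistPartner W W' D' →
    StarredPotSSAtFive W → ¬ (5 : ℤ) ∣ D'.maninConstant → ¬ (5 : ℤ) ∣ D.maninConstant

/-- **Partner existence.**  Every cell row `(W, D)` has a twist partner `(W', D')` at the same level which is
again a cell row and again potentially supersingular of twist-minimal type (II, IV, IV\*, II\*): modularity of
`W ⊗ χ₅` (conductor unchanged: the twist is again additive at 5), existence of the `X₀(N)`-optimal curve in its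
class with a lattice-optimal parametrisation, `E[5]`-reducibility and the twist condition being isogeny- and
`χ₅`-invariant.  Literature-level (BCDT + optimal quotient), not a new claim. -/
def TwistPartnerExists : Prop :=
  ∀ (W : WeierstrassCurve ℚ) [W.IsElliptic] [W.IsGloballyMinimal] {N : ℕ} [NeZero N]
    (D : ModularParametrizationData W N) (hp : (5 : ℕ).Prime),
    InCell W D hp → (UnstarredPotSSAtFive W ∨ StarredPotSSAtFive W) →
    ∃ (W' : WeierstrassCurve ℚ) (_ : W'.IsElliptic) (_ : W'.IsGloballyMinimal)
      (D' : ModularParametrizationData W' N),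
      InCell W' D' hp ∧ IsTwistPartner W W' D' ∧ (UnstarredPotSSAtFive W' ∨ StarredPotSSAtFive W')

/-- **R_cc — the residual's residual after transport**: the crux (at `p = 5`) on rows whose optimal curve AND
whose twist partner's optimal curve are BOTH starred.  Conjecturally vacuous twice over (Q\* for either member);
invisible to modular degrees (`deg φ_f / deg φ_g` is a `5`-unit exactly as in the unstarred configuration). -/
def DoublyStarredResidual : Prop :=
  mazur_not_dvd_maninConstant_of_odd → abbesUllmo_not_dvd_maninConstant_of_not_dvd_level →
  cesnavicius_not_two_dvd_maninConstant_of_two_dvd_level → exists_isNewformOf →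
  ∀ (W W' : WeierstrassCurve ℚ) [W.IsElliptic] [W.IsGloballyMinimal] [W'.IsElliptic] [W'.IsGloballyMinimal]
    {N : ℕ} [NeZero N] (D : ModularParametrizationData W N) (D' : ModularParametrizationData W' N)
    (hp : (5 : ℕ).Prime),
    InCell W D hp → InCell W' D' hp → IsTwistPartner W W' D' →
    StarredPotSSAtFive W → StarredPotSSAtFive W' → ¬ (5 : ℤ) ∣ D.maninConstant

/-- Starred rows are potentially supersingular rows (trivial direction used by the split). -/
theorem type_of_starred {W : WeierstrassCurve ℚ} (h : StarredPotSSAtFive W) :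
    UnstarredPotSSAtFive W ∨ StarredPotSSAtFive W := Or.inr h

/-- **The transport split (PROVED).**  Off-rows crux + partner existence + starred transport + R_cc ⇒ R_c. -/
theorem starredResidual_of_transport (hoff : CruxOffStarredSSAtFive) (hex : TwistPartnerExists)
    (htr : StarredTwistTransport) (hcc : DoublyStarredResidual) : StarredSSResidualAtFive := by
  intro h1 h2 h3 h4 W _ _ N _ D hp hN hred htw hlat hstar
  obtain ⟨W', i1, i2, D', hcell', hpart, htype'⟩ := hex W D hp ⟨hN, hred, htw, hlat⟩ (type_of_starred hstar)
  rcases htype' with hun' | hst'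
  · -- the partner's optimal curve is unstarred: the off-rows crux decides it, transport carries it over
    have hc' : ¬ (5 : ℤ) ∣ D'.maninConstant := by
      have := hoff h1 h2 h3 h4 W' D' 5 hp (Or.inl rfl) hcell'.1 hcell'.2.1 hcell'.2.2.1 hcell'.2.2.2
        (by rintro ⟨_, hs'⟩; exact not_starred_of_unstarred hun' hs')
      exact_mod_cast this
    exact htr W W' D D' hp ⟨hN, hred, htw, hlat⟩ hcell' hpart hstar hc'
  · -- both starred: the doubly-starred residual
    exact hcc h1 h2 h3 h4 W W' D D' hp ⟨hN, hred, htw, hlat⟩ hcell' hpart hstar hst'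

/-- **Assembly to the crux (PROVED)**, through the §8d split `crux_of_off_of_residual`. -/
theorem crux_of_transport (hoff : CruxOffStarredSSAtFive) (hex : TwistPartnerExists)
    (htr : StarredTwistTransport) (hcc : DoublyStarredResidual) :
    Theses.TwistFamilyManinDescent.EisensteinAdditiveManinResidual :=
  crux_of_off_of_residual hoff (starredResidual_of_transport hoff hex htr hcc)

end Summit.BirchSwinnertonDyer.BirchSwinnertonDyer.Cruxes.EisensteinAdditiveManinResidual.TwistPair
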